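import Summits.BirchSwinnertonDyer.Rank1Residual.X4.HeckeShiftedDerivativeFamily
import Summits.BirchSwinnertonDyer.Rank1Residual.X4.KuriharaAdditiveCertificate
import HarnessLib

/-!
# The ADDITIVE certificate is a HECKE 1-COCYCLE: it follows from LEVEL-1 data `{τ_q}` (one periodic function per Kolyvagin prime) plus the pairwise COCYCLE condition `(H_q − a_q) τ_{q'} = (H_{q'} − a_{q'}) τ_q` — and the cocycle condition is automatic when the `τ_q` lie in an `H`-stable module on which `1 − [ℓ₂]` is injective (cell `b2b-bsdres`, seat additive-p4 gen 32, line V54; CLASS-CLOSURE §3.1 N11 SPREAD rows)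

HONEST FRAMING (verbatim, cell `b2b-bsdres`): the goal of the cell is to DELETE the COMBINATION-SHAPED
residual classes for ALL analytic-rank `≤ 1` curves over `ℚ` — "full BSD formula for every rank `≤ 1`
curve in class `C`" assembled STRICTLY from published theorems — so that the rank-`≤ 1` remainder
becomes exactly the CONSTRUCTION-SHAPED classes, which are TYPED (missing-input Props), NOT attempted;
this is not "finishing BSD". This file: research-route KERNEL THEOREMS (pure algebra of periodic
functions over the tree's `heckeTransform`; no named fact, no conjecture, nothing booked; X4 stays
CONSTRUCTION-SHAPED; no Literature fact is minted; labels unchanged; 0 defs).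

## What is proved

Gen 31's certificate `PlusSymbolLevelLowersAdditivelyModAt W p f m ℓ₁ ℓ₂`
(`X4/KuriharaAdditiveCertificate.lean`) asks for three FAMILIES `Dα, Dβ, τ` indexed by all finite sets
`U` of Kolyvagin primes, with Hecke-derivative relations at every Kolyvagin `q ∉ U` and the
`τ`-identities on every non-empty `U`. This file reduces it to data at the SINGLE primes:

* `shiftDeriv_erase_eq_of_cocycle` — under the COCYCLE condition `E_q τ_{q'} = E_{q'} τ_q`
  (`E_q = H_q − a_q`, `X4/HeckeShiftedDerivativeFamily.lean`) the function
  `D_{U∖{q₀}} τ_{q₀}` does not depend on the base point `q₀ ∈ U`: the family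
  `τ_U := D_{U∖{q₀}} τ_{q₀}` is well defined.
* `heckeTransform_familyK`, `heckeTransform_tauFamily` — the relations
  `H_q (D U) = a_q·D U + D(U ∪ {q})` for `D U = [U ⊆ 𝒦] D^a_U γ` and for the `τ`-family.
* `shiftDeriv_eq_tauFamily_sub` — the `τ`-identity at level `1`, `E_q α = τ_q − τ_q∘[ℓ₂]`,
  propagates to every level: `D^a_U α = τ_U − τ_U∘[ℓ₂]` (the inner shift commutes out,
  `shiftDeriv_heckeShift`, and `D_U` commutes with `[ℓ₂]`, `ℓ₂` prime to the Kolyvagin primes).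
* **`plusSymbolLevelLowersAdditivelyModAt_of_cocycle`** — THE PACKAGING THEOREM: periodic `α, β`,
  periodic `τ_q` (`q ∈ 𝒫_1(E,p)`) with `E_q α = τ_q − τ_q∘[ℓ₂]`, `E_q β = −(τ_q − τ_q∘[ℓ₁])`, the
  cocycle condition on pairs of Kolyvagin primes, and the decomposition
  `\overline{[r]⁺_f} = (α r − α(ℓ₁ r)) + (β r − β(ℓ₂ r))` ⟹ the certificate (`ℓ_i ∣ N_E`, `a_q = a_q(E)
  mod m`). Witnesses: `Dα U = D^a_U α`, `Dβ U = D^a_U β`, `τ_U = D^a_{U∖{min U}} τ_{min U}`.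
* **`heckeShift_cocycle_of_injective`** — the cocycle condition is AUTOMATIC when every `τ_q` lies
  in a set `P₀` of periodic functions closed under differences and under the `E_q`, on which
  `g ↦ g − g∘[ℓ₂]` is injective: `E_q τ_{q'} − E_{q'} τ_q ∈ P₀` has `(1−[ℓ₂])`-image
  `E_q E_{q'} α − E_{q'} E_q α = 0`. (On the rows: `P₀` = the non-Eisenstein part of the level-`N/ℓ₁ℓ₂`
  symbols mod `p^e`, where injectivity of `1 − [ℓ₂]` is Ihara's lemma — instrument E9/E9b measured the
  raw kernels to be Eisenstein.)
* `plusSymbolLevelLowersAdditivelyModAt_of_levelOne_of_injective` — the two combined.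

So the per-row certificate is: the FREE decomposition `(α, β)` + ONE `τ_q` per Kolyvagin prime inside an
Ihara-injective `H`-stable module — exactly what instrument E9b (`thjoint`) computes on generators;
`X4/KuriharaAdditiveCertificateOfExactness.lean` (this line) removes the `τ_q` as data altogether.

## References

* B. Mazur, J. Tate, J. Teitelbaum, Invent. Math. 84 (1986), §I.4 (4.2). [cite: MazurTateTeitelbaum1986Invent, §I.4 (4.2)]
* C.-H. Kim, Amer. J. Math. 148 (2026), §1.4.3, §1.5.1. [cite: Kim2022StructureSelmer, §1.4.3 and §1.5.1 (PDF p. 7)]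
* K. A. Ribet, Proc. ICM 1983 (1984), Thm. 4.1 (Ihara's lemma; provenance of the injectivity hypothesis, not an input here). [cite: Ribet1984ICM, Thm. 4.1]
-/

noncomputable section

open scoped MatrixGroups ModularForm

open CongruenceSubgroup Finset

open Literature.NumberTheory.EllipticCurves Literature.NumberTheory.EllipticCurves.ModularForms

open Literature.NumberTheory.DiophantineGeometry.Dioph (ratModP)

namespace Summit.BirchSwinnertonDyer.Rank1Residual.LevelLowering

/-! ### §1 Abstract level: a predicate `K` of "Kolyvagin primes" (all prime), a shift `a`, level-1 data `τ₁` -/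

section Abstract

variable {R : Type*} [CommRing R] (a : ℕ → R) {K : ℕ → Prop}

/-- **BASE-POINT INDEPENDENCE under the cocycle condition.** If `E_q τ_{q'} = E_{q'} τ_q` for all
distinct `q, q' ∈ 𝒦` (periodic `τ_q`, `𝒦` a set of primes), then for `U ⊆ 𝒦` and `q₀, q₁ ∈ U`:
`D_{U∖{q₀}} τ_{q₀} = D_{U∖{q₁}} τ_{q₁}`. [cite: MazurTateTeitelbaum1986Invent, §I.4 (4.2)] -/
theorem shiftDeriv_erase_eq_of_cocycle (hK : ∀ q, K q → q.Prime) {τ₁ : ℕ → ℚ → R}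
    (hτ : ∀ q, K q → IsPeriodic (τ₁ q))
    (hcoc : ∀ q q', K q → K q' → q ≠ q' → heckeShift a q (τ₁ q') = heckeShift a q' (τ₁ q))
    {U : Finset ℕ} (hU : ∀ q ∈ U, K q) {q₀ q₁ : ℕ} (h₀ : q₀ ∈ U) (h₁ : q₁ ∈ U) :
    shiftDeriv a (τ₁ q₀) (U.erase q₀) = shiftDeriv a (τ₁ q₁) (U.erase q₁) := by
  by_cases hne : q₀ = q₁
  · subst hne; rfl
  set V := (U.erase q₀).erase q₁ with hV
  have hV' : V = (U.erase q₁).erase q₀ := by rw [hV, Finset.erase_right_comm]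
  have hVK : ∀ q ∈ V, q.Prime := fun q hq ↦
    hK q (hU q (Finset.mem_of_mem_erase (Finset.mem_of_mem_erase hq)))
  have h1V : q₁ ∉ V := fun h ↦ by simp [hV] at h
  have h0V : q₀ ∉ V := fun h ↦ by simp [hV'] at h
  have hU0 : U.erase q₀ = insert q₁ V := by
    rw [hV, Finset.insert_erase (Finset.mem_erase.mpr ⟨Ne.symm hne, h₁⟩)]
  have hU1 : U.erase q₁ = insert q₀ V := by
    rw [hV', Finset.insert_erase (Finset.mem_erase.mpr ⟨hne, h₀⟩)]
  rw [hU0, hU1, ← shiftDeriv_heckeShift a (hτ q₀ (hU q₀ h₀)) hVK (hK q₁ (hU q₁ h₁)) h1V,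
    ← shiftDeriv_heckeShift a (hτ q₁ (hU q₁ h₁)) hVK (hK q₀ (hU q₀ h₀)) h0V,
    hcoc q₁ q₀ (hU q₁ h₁) (hU q₀ h₀) (Ne.symm hne)]

/-- **The Hecke relation for a family supported on `𝒦`-sets**: `D U = D^a_U γ` when `U ⊆ 𝒦` and
`D U = 0` otherwise satisfies `H_q (D U) = a_q·D U + D(U ∪ {q})` at every `q ∈ 𝒦`, `q ∉ U`
(`γ` periodic). [folklore] -/
theorem heckeTransform_familyK (hK : ∀ q, K q → q.Prime) {γ : ℚ → R} (hγ : IsPeriodic γ)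
    (D : Finset ℕ → ℚ → R) (hD : ∀ U, (∀ q ∈ U, K q) → D U = shiftDeriv a γ U)
    (hD0 : ∀ U, ¬ (∀ q ∈ U, K q) → D U = fun _ ↦ 0)
    (U : Finset ℕ) {q : ℕ} (hq : K q) (hqU : q ∉ U) (r : ℚ) :
    heckeTransform q (D U) r = a q * D U r + D (insert q U) r := by
  by_cases hU : ∀ x ∈ U, K x
  · have hU' : ∀ x ∈ insert q U, K x := by
      intro x hx
      rcases Finset.mem_insert.mp hx with rfl | hx
      exacts [hq, hU x hx]
    rw [hD U hU, hD _ hU']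
    exact heckeTransform_shiftDeriv a hγ (fun x hx ↦ hK x (hU x hx)) (hK q hq) hqU r
  · have hU' : ¬ ∀ x ∈ insert q U, K x := fun h ↦ hU fun x hx ↦ h x (Finset.mem_insert_of_mem hx)
    rw [hD0 U hU, hD0 _ hU']
    simp [heckeTransform_zero]

/-- Periodicity of a family supported on `𝒦`-sets. [folklore] -/
theorem isPeriodic_familyK (hK : ∀ q, K q → q.Prime) {γ : ℚ → R} (hγ : IsPeriodic γ)
    (D : Finset ℕ → ℚ → R) (hD : ∀ U, (∀ q ∈ U, K q) → D U = shiftDeriv a γ U)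
    (hD0 : ∀ U, ¬ (∀ q ∈ U, K q) → D U = fun _ ↦ 0) (U : Finset ℕ) : IsPeriodic (D U) := by
  by_cases hU : ∀ x ∈ U, K x
  · rw [hD U hU]; exact hγ.shiftDeriv a fun x hx ↦ hK x (hU x hx)
  · rw [hD0 U hU]; exact isPeriodic_zero

variable {τ₁ : ℕ → ℚ → R}

/-- **The Hecke relation for the `τ`-family** `τ_U = D_{U∖{q₀}} τ_{q₀}` (any `q₀ ∈ U ⊆ 𝒦`; `0` off the
non-empty `𝒦`-sets): `H_q τ_U = a_q τ_U + τ_{U∪q}` for `U ≠ ∅`, `q ∈ 𝒦 ∖ U`. [folklore] -/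
theorem heckeTransform_tauFamily (hK : ∀ q, K q → q.Prime) (hτ : ∀ q, K q → IsPeriodic (τ₁ q))
    (τ : Finset ℕ → ℚ → R)
    (hτdef : ∀ U q₀, (∀ q ∈ U, K q) → q₀ ∈ U → τ U = shiftDeriv a (τ₁ q₀) (U.erase q₀))
    (hτ0 : ∀ U : Finset ℕ, ¬ (U.Nonempty ∧ ∀ q ∈ U, K q) → τ U = fun _ ↦ 0)
    {U : Finset ℕ} (hne : U.Nonempty) {q : ℕ} (hq : K q) (hqU : q ∉ U) (r : ℚ) :
    heckeTransform q (τ U) r = a q * τ U r + τ (insert q U) r := by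
  by_cases hU : ∀ x ∈ U, K x
  · obtain ⟨q₀, h₀⟩ := hne
    have hU' : ∀ x ∈ insert q U, K x := by
      intro x hx
      rcases Finset.mem_insert.mp hx with rfl | hx
      exacts [hq, hU x hx]
    have hq0 : q ≠ q₀ := fun h ↦ hqU (h ▸ h₀)
    rw [hτdef U q₀ hU h₀, hτdef (insert q U) q₀ hU' (Finset.mem_insert_of_mem h₀),
      Finset.erase_insert_of_ne hq0]
    have hVK : ∀ x ∈ U.erase q₀, x.Prime := fun x hx ↦ hK x (hU x (Finset.mem_of_mem_erase hx))
    have hqV : q ∉ U.erase q₀ := fun h ↦ hqU (Finset.mem_of_mem_erase h)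
    exact heckeTransform_shiftDeriv a (hτ q₀ (hU q₀ h₀)) hVK (hK q hq) hqV r
  · have hU' : ¬ ((insert q U).Nonempty ∧ ∀ x ∈ insert q U, K x) :=
      fun h ↦ hU fun x hx ↦ h.2 x (Finset.mem_insert_of_mem hx)
    rw [hτ0 U (fun h ↦ hU h.2), hτ0 _ hU']
    simp [heckeTransform_zero]

/-- Periodicity of the `τ`-family. [folklore] -/
theorem isPeriodic_tauFamily (hK : ∀ q, K q → q.Prime) (hτ : ∀ q, K q → IsPeriodic (τ₁ q))
    (τ : Finset ℕ → ℚ → R)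
    (hτdef : ∀ U q₀, (∀ q ∈ U, K q) → q₀ ∈ U → τ U = shiftDeriv a (τ₁ q₀) (U.erase q₀))
    (hτ0 : ∀ U : Finset ℕ, ¬ (U.Nonempty ∧ ∀ q ∈ U, K q) → τ U = fun _ ↦ 0) (U : Finset ℕ) :
    IsPeriodic (τ U) := by
  by_cases hU : U.Nonempty ∧ ∀ x ∈ U, K x
  · obtain ⟨⟨q₀, h₀⟩, hUK⟩ := hU
    rw [hτdef U q₀ hUK h₀]
    exact (hτ q₀ (hUK q₀ h₀)).shiftDeriv a fun x hx ↦ hK x (hUK x (Finset.mem_of_mem_erase hx))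
  · rw [hτ0 U hU]; exact isPeriodic_zero

/-- **The `τ`-identity propagates from level `1` to every level**: if `E_q γ = ε·(τ_q − τ_q∘[c])` for
every `q ∈ 𝒦` (`ε = ±1` a fixed scalar, `c` prime to `𝒦`, all functions periodic), then
`D^a_U γ = ε·(τ_U − τ_U∘[c])` on every non-empty `U ⊆ 𝒦`. [cite: MazurTateTeitelbaum1986Invent, §I.4 (4.2)] -/
theorem shiftDeriv_eq_tauFamily_sub (hK : ∀ q, K q → q.Prime) (hτ : ∀ q, K q → IsPeriodic (τ₁ q))
    (τ : Finset ℕ → ℚ → R)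
    (hτdef : ∀ U q₀, (∀ q ∈ U, K q) → q₀ ∈ U → τ U = shiftDeriv a (τ₁ q₀) (U.erase q₀))
    {γ : ℚ → R} (hγ : IsPeriodic γ) {c : ℕ} (hc : ∀ q, K q → c.Coprime q) (ε : R)
    (h1 : ∀ q, K q → heckeShift a q γ = fun r ↦ ε * (τ₁ q r - τ₁ q (c * r)))
    {U : Finset ℕ} (hne : U.Nonempty) (hU : ∀ q ∈ U, K q) (r : ℚ) :
    shiftDeriv a γ U r = ε * (τ U r - τ U (c * r)) := by
  obtain ⟨q₀, h₀⟩ := hne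
  have hVK : ∀ x ∈ U.erase q₀, x.Prime := fun x hx ↦ hK x (hU x (Finset.mem_of_mem_erase hx))
  have hVc : ∀ x ∈ U.erase q₀, c.Coprime x := fun x hx ↦ hc x (hU x (Finset.mem_of_mem_erase hx))
  have hq0V : q₀ ∉ U.erase q₀ := fun h ↦ by simp at h
  rw [hτdef U q₀ hU h₀]
  conv_lhs => rw [← Finset.insert_erase h₀]
  rw [← shiftDeriv_heckeShift a hγ hVK (hK q₀ (hU q₀ h₀)) hq0V, h1 q₀ (hU q₀ h₀)]
  have hfun : (fun r ↦ ε * (τ₁ q₀ r - τ₁ q₀ (c * r))) =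
      fun r ↦ ε * (fun x ↦ τ₁ q₀ x - τ₁ q₀ (c * x)) r := rfl
  rw [hfun, shiftDeriv_const_mul, shiftDeriv_sub_comp_natMul a (hτ q₀ (hU q₀ h₀)) hVK hVc]

/-- **THE COCYCLE CONDITION IS AUTOMATIC under injectivity of `1 − [c]`.** Let `P₀` be a set of
periodic functions closed under differences and under every `E_q` (`q ∈ 𝒦`), on which
`g ↦ g − g∘[c]` is injective (`c` prime to `𝒦`). If every `τ_q ∈ P₀` and `E_q α = τ_q − τ_q∘[c]`
(`q ∈ 𝒦`, `α` periodic), then `E_q τ_{q'} = E_{q'} τ_q` for all `q ≠ q'` in `𝒦` — the difference lies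
in `P₀` and its `(1 − [c])`-image is `E_q E_{q'} α − E_{q'} E_q α = 0`. On the rows `P₀` is the
non-Eisenstein part of the level-`N/ℓ₁ℓ₂` symbols, where the injectivity is Ihara's lemma
(provenance; a hypothesis here). [cite: Ribet1984ICM, Thm. 4.1] [cite: MazurTateTeitelbaum1986Invent, §I.4 (4.2)] -/
theorem heckeShift_cocycle_of_injective (hK : ∀ q, K q → q.Prime) {P₀ : Set (ℚ → R)}
    (hP : ∀ g ∈ P₀, IsPeriodic g)
    (hsub : ∀ g ∈ P₀, ∀ h ∈ P₀, (fun r ↦ g r - h r) ∈ P₀)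
    (hE : ∀ q, K q → ∀ g ∈ P₀, heckeShift a q g ∈ P₀)
    {c : ℕ} (hc : ∀ q, K q → c.Coprime q)
    (hinj : ∀ g ∈ P₀, (∀ r, g r - g (c * r) = 0) → g = fun _ ↦ 0)
    (hτP : ∀ q, K q → τ₁ q ∈ P₀) {α : ℚ → R} (hα : IsPeriodic α)
    (h1 : ∀ q, K q → heckeShift a q α = fun r ↦ τ₁ q r - τ₁ q (c * r)) :
    ∀ q q', K q → K q' → q ≠ q' → heckeShift a q (τ₁ q') = heckeShift a q' (τ₁ q) := by
  intro q q' hq hq' hne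
  have hτq : IsPeriodic (τ₁ q) := hP _ (hτP q hq)
  have hτq' : IsPeriodic (τ₁ q') := hP _ (hτP q' hq')
  set g : ℚ → R := fun r ↦ heckeShift a q (τ₁ q') r - heckeShift a q' (τ₁ q) r with hg
  have hgP : g ∈ P₀ := hsub _ (hE q hq _ (hτP q' hq')) _ (hE q' hq' _ (hτP q hq))
  have hzero : g = fun _ ↦ 0 := by
    refine hinj g hgP fun r ↦ ?_
    -- `(1 − [c]) E_q τ_{q'} = E_q (τ_{q'} − τ_{q'}∘[c]) = E_q E_{q'} α`, and symmetrically
    have hA' : (fun r ↦ heckeShift a q (τ₁ q') r - heckeShift a q (τ₁ q') (c * r)) =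
        heckeShift a q (heckeShift a q' α) := by
      rw [h1 q' hq', show (fun r ↦ τ₁ q' r - τ₁ q' (c * r)) =
          fun r ↦ τ₁ q' r - (fun y ↦ τ₁ q' (c * y)) r from rfl, heckeShift_sub,
        heckeShift_comp_natMul a hτq' (hK q hq) (hc q hq)]
    have hB' : (fun r ↦ heckeShift a q' (τ₁ q) r - heckeShift a q' (τ₁ q) (c * r)) =
        heckeShift a q' (heckeShift a q α) := by
      rw [h1 q hq, show (fun r ↦ τ₁ q r - τ₁ q (c * r)) =
          fun r ↦ τ₁ q r - (fun y ↦ τ₁ q (c * y)) r from rfl, heckeShift_sub,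
        heckeShift_comp_natMul a hτq (hK q' hq') (hc q' hq')]
    have hA : heckeShift a q (τ₁ q') r - heckeShift a q (τ₁ q') (c * r) =
        heckeShift a q (heckeShift a q' α) r := congrFun hA' r
    have hB : heckeShift a q' (τ₁ q) r - heckeShift a q' (τ₁ q) (c * r) =
        heckeShift a q' (heckeShift a q α) r := congrFun hB' r
    have hcomm := congrFun (heckeShift_comm a hα (hK q hq) (hK q' hq') hne) r
    simp only [hg]
    calc heckeShift a q (τ₁ q') r - heckeShift a q' (τ₁ q) r -
          (heckeShift a q (τ₁ q') (c * r) - heckeShift a q' (τ₁ q) (c * r))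
        = (heckeShift a q (τ₁ q') r - heckeShift a q (τ₁ q') (c * r)) -
            (heckeShift a q' (τ₁ q) r - heckeShift a q' (τ₁ q) (c * r)) := by ring
      _ = 0 := by rw [hA, hB, hcomm, sub_self]
  funext r
  have := congrFun hzero r
  simp only [hg] at this
  exact sub_eq_zero.mp this

end Abstract

/-! ### §2 The packaging theorem for the additive certificate of `X4/KuriharaAdditiveCertificate.lean` -/

section Packaging

variable {W : WeierstrassCurve ℚ} [W.IsGloballyMinimal] {p : ℕ} {N : ℕ} {f : CuspForm (Gamma0 N) 2}

/-- Kolyvagin primes are prime to every divisor of the conductor. [folklore] -/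
theorem coprime_of_isKolyvaginPrime_of_dvd {ℓ q : ℕ} (hℓ : ℓ ∣ W.conductorNorm ℤ)
    (hq : Kato.IsKolyvaginPrime W p 1 q) : ℓ.Coprime q := by
  rw [Nat.coprime_comm, Nat.Prime.coprime_iff_not_dvd hq.prime]
  exact fun h ↦ hq.not_dvd_conductorNorm (dvd_trans h hℓ)

/-- **THE ADDITIVE CERTIFICATE FROM LEVEL-1 DATA + THE COCYCLE CONDITION.** Modulus `m`, shift
`a_q = a_q(E) mod m`, `E_q = H_q − a_q`, `ℓ₁, ℓ₂ ∣ N_E`. Data: periodic `α, β : ℚ → ℤ/m`; for every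
Kolyvagin prime `q ∈ 𝒫_1(E,p)` a periodic `τ_q` with `E_q α = τ_q − τ_q∘[ℓ₂]` and
`E_q β = −(τ_q − τ_q∘[ℓ₁])`; the COCYCLE condition `E_q τ_{q'} = E_{q'} τ_q` on pairs of distinct
Kolyvagin primes; the decomposition `\overline{[r]⁺_f} = (α r − α(ℓ₁ r)) + (β r − β(ℓ₂ r))`. Then
`PlusSymbolLevelLowersAdditivelyModAt W p f m ℓ₁ ℓ₂` holds, with witnesses `Dα U = D^a_U α`,
`Dβ U = D^a_U β`, `τ_U = D^a_{U∖{q₀}} τ_{q₀}` (families supported on the sets of Kolyvagin primes).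
[cite: Kim2022StructureSelmer, §1.4.3 and §1.5.1 (PDF p. 7)] [cite: MazurTateTeitelbaum1986Invent, §I.4 (4.2)] -/
theorem plusSymbolLevelLowersAdditivelyModAt_of_cocycle {m ℓ₁ ℓ₂ : ℕ}
    (hℓ₁ : ℓ₁ ∣ W.conductorNorm ℤ) (hℓ₂ : ℓ₂ ∣ W.conductorNorm ℤ)
    {α β : ℚ → ZMod m} (hα : IsPeriodic α) (hβ : IsPeriodic β)
    (τ₁ : ℕ → ℚ → ZMod m) (hτ : ∀ q, Kato.IsKolyvaginPrime W p 1 q → IsPeriodic (τ₁ q))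
    (h1 : ∀ q, Kato.IsKolyvaginPrime W p 1 q →
      heckeShift (fun q ↦ (W.frobeniusTrace q : ZMod m)) q α = fun r ↦ τ₁ q r - τ₁ q (ℓ₂ * r))
    (h2 : ∀ q, Kato.IsKolyvaginPrime W p 1 q →
      heckeShift (fun q ↦ (W.frobeniusTrace q : ZMod m)) q β = fun r ↦ -(τ₁ q r - τ₁ q (ℓ₁ * r)))
    (hcoc : ∀ q q', Kato.IsKolyvaginPrime W p 1 q → Kato.IsKolyvaginPrime W p 1 q' → q ≠ q' →
      heckeShift (fun q ↦ (W.frobeniusTrace q : ZMod m)) q (τ₁ q') =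
        heckeShift (fun q ↦ (W.frobeniusTrace q : ZMod m)) q' (τ₁ q))
    (hsym : ∀ r : ℚ, ratModP m (ratPlusSymbol f r) = (α r - α (ℓ₁ * r)) + (β r - β (ℓ₂ * r))) :
    PlusSymbolLevelLowersAdditivelyModAt W p f m ℓ₁ ℓ₂ := by
  classical
  set a : ℕ → ZMod m := fun q ↦ (W.frobeniusTrace q : ZMod m) with ha
  set K : ℕ → Prop := fun q ↦ Kato.IsKolyvaginPrime W p 1 q with hKdef
  have hK : ∀ q, K q → q.Prime := fun q hq ↦ hq.prime
  have hc₁ : ∀ q, K q → ℓ₁.Coprime q := fun q hq ↦ coprime_of_isKolyvaginPrime_of_dvd hℓ₁ hq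
  have hc₂ : ∀ q, K q → ℓ₂.Coprime q := fun q hq ↦ coprime_of_isKolyvaginPrime_of_dvd hℓ₂ hq
  -- the three families
  let Dα : Finset ℕ → ℚ → ZMod m := fun U ↦ if ∀ q ∈ U, K q then shiftDeriv a α U else fun _ ↦ 0
  let Dβ : Finset ℕ → ℚ → ZMod m := fun U ↦ if ∀ q ∈ U, K q then shiftDeriv a β U else fun _ ↦ 0
  let τ : Finset ℕ → ℚ → ZMod m := fun U ↦
    if h : U.Nonempty ∧ ∀ q ∈ U, K q then shiftDeriv a (τ₁ (U.min' h.1)) (U.erase (U.min' h.1))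
    else fun _ ↦ 0
  have hDα : ∀ U, (∀ q ∈ U, K q) → Dα U = shiftDeriv a α U := fun U hU ↦ if_pos hU
  have hDα0 : ∀ U, ¬ (∀ q ∈ U, K q) → Dα U = fun _ ↦ 0 := fun U hU ↦ if_neg hU
  have hDβ : ∀ U, (∀ q ∈ U, K q) → Dβ U = shiftDeriv a β U := fun U hU ↦ if_pos hU
  have hDβ0 : ∀ U, ¬ (∀ q ∈ U, K q) → Dβ U = fun _ ↦ 0 := fun U hU ↦ if_neg hU
  have hτdef : ∀ U q₀, (∀ q ∈ U, K q) → q₀ ∈ U → τ U = shiftDeriv a (τ₁ q₀) (U.erase q₀) := by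
    intro U q₀ hU h₀
    have h : U.Nonempty ∧ ∀ q ∈ U, K q := ⟨⟨q₀, h₀⟩, hU⟩
    show (if h : U.Nonempty ∧ ∀ q ∈ U, K q then
      shiftDeriv a (τ₁ (U.min' h.1)) (U.erase (U.min' h.1)) else fun _ ↦ 0) = _
    rw [dif_pos h]
    exact shiftDeriv_erase_eq_of_cocycle a hK hτ hcoc hU (Finset.min'_mem U h.1) h₀
  have hτ0 : ∀ U : Finset ℕ, ¬ (U.Nonempty ∧ ∀ q ∈ U, K q) → τ U = fun _ ↦ 0 :=
    fun U hU ↦ dif_neg hU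
  refine ⟨Dα, Dβ, τ, isPeriodic_familyK a hK hα Dα hDα hDα0, isPeriodic_familyK a hK hβ Dβ hDβ hDβ0,
    isPeriodic_tauFamily a hK hτ τ hτdef hτ0, ?_, ?_, ?_, ?_, ?_, ?_⟩
  · intro U q hq hqU r
    exact heckeTransform_familyK a hK hα Dα hDα hDα0 U hq hqU r
  · intro U q hq hqU r
    exact heckeTransform_familyK a hK hβ Dβ hDβ hDβ0 U hq hqU r
  · intro U hne q hq hqU r
    exact heckeTransform_tauFamily a hK hτ τ hτdef hτ0 hne hq hqU r
  · intro U hne hU r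
    rw [hDα U hU]
    have := shiftDeriv_eq_tauFamily_sub a hK hτ τ hτdef hα hc₂ 1
      (fun q hq ↦ by rw [h1 q hq]; funext r; ring) hne hU r
    rw [this, one_mul]
  · intro U hne hU r
    rw [hDβ U hU]
    have := shiftDeriv_eq_tauFamily_sub a hK hτ τ hτdef hβ hc₁ (-1)
      (fun q hq ↦ by rw [h2 q hq]; funext r; ring) hne hU r
    rw [this]
    ring
  · intro r
    have hα0 : Dα ∅ = α := by rw [hDα ∅ (by simp), shiftDeriv_empty]
    have hβ0 : Dβ ∅ = β := by rw [hDβ ∅ (by simp), shiftDeriv_empty]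
    rw [hα0, hβ0]
    exact hsym r

/-- **THE ADDITIVE CERTIFICATE FROM LEVEL-1 DATA IN AN IHARA-INJECTIVE MODULE** (the two theorems
combined): periodic `α, β`; a set `P₀` of periodic `ℤ/m`-valued functions closed under differences
and under the `E_q` (`q ∈ 𝒫_1(E,p)`) on which `g ↦ g − g∘[ℓ₂]` is injective; `τ_q ∈ P₀` with
`E_q α = τ_q − τ_q∘[ℓ₂]`, `E_q β = −(τ_q − τ_q∘[ℓ₁])` for every Kolyvagin `q`; the decomposition of
`\overline{[r]⁺_f}` ⟹ `PlusSymbolLevelLowersAdditivelyModAt W p f m ℓ₁ ℓ₂` — no cocycle condition to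
check. Per row (EVIDENCE, instrument E9b): `P₀` = an `H`-stable part of the level-`N/ℓ₁ℓ₂` plus
symbols mod `p^e` with trivial `(1−[ℓ₂])`-kernel (the raw kernels are Eisenstein).
[cite: Kim2022StructureSelmer, §1.4.3 and §1.5.1 (PDF p. 7)] [cite: Ribet1984ICM, Thm. 4.1] -/
theorem plusSymbolLevelLowersAdditivelyModAt_of_levelOne_of_injective {m ℓ₁ ℓ₂ : ℕ}
    (hℓ₁ : ℓ₁ ∣ W.conductorNorm ℤ) (hℓ₂ : ℓ₂ ∣ W.conductorNorm ℤ)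
    {α β : ℚ → ZMod m} (hα : IsPeriodic α) (hβ : IsPeriodic β)
    {P₀ : Set (ℚ → ZMod m)} (hP : ∀ g ∈ P₀, IsPeriodic g)
    (hsub : ∀ g ∈ P₀, ∀ h ∈ P₀, (fun r ↦ g r - h r) ∈ P₀)
    (hE : ∀ q, Kato.IsKolyvaginPrime W p 1 q → ∀ g ∈ P₀,
      heckeShift (fun q ↦ (W.frobeniusTrace q : ZMod m)) q g ∈ P₀)
    (hinj : ∀ g ∈ P₀, (∀ r, g r - g (ℓ₂ * r) = 0) → g = fun _ ↦ 0)
    (τ₁ : ℕ → ℚ → ZMod m) (hτP : ∀ q, Kato.IsKolyvaginPrime W p 1 q → τ₁ q ∈ P₀)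
    (h1 : ∀ q, Kato.IsKolyvaginPrime W p 1 q →
      heckeShift (fun q ↦ (W.frobeniusTrace q : ZMod m)) q α = fun r ↦ τ₁ q r - τ₁ q (ℓ₂ * r))
    (h2 : ∀ q, Kato.IsKolyvaginPrime W p 1 q →
      heckeShift (fun q ↦ (W.frobeniusTrace q : ZMod m)) q β = fun r ↦ -(τ₁ q r - τ₁ q (ℓ₁ * r)))
    (hsym : ∀ r : ℚ, ratModP m (ratPlusSymbol f r) = (α r - α (ℓ₁ * r)) + (β r - β (ℓ₂ * r))) :
    PlusSymbolLevelLowersAdditivelyModAt W p f m ℓ₁ ℓ₂ :=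
  plusSymbolLevelLowersAdditivelyModAt_of_cocycle hℓ₁ hℓ₂ hα hβ τ₁ (fun q hq ↦ hP _ (hτP q hq)) h1 h2
    (heckeShift_cocycle_of_injective (fun q ↦ (W.frobeniusTrace q : ZMod m))
      (K := fun q ↦ Kato.IsKolyvaginPrime W p 1 q) (fun _ hq ↦ hq.prime) hP hsub hE
      (fun _ hq ↦ coprime_of_isKolyvaginPrime_of_dvd hℓ₂ hq) hinj hτP hα h1)
    hsym

end Packaging

end Summit.BirchSwinnertonDyer.Rank1Residual.LevelLowering

end
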